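import Summits.QuantumFields.YangMills.Theorems.ConvexGribovBodyContinuumLegGivenGapDock
import Summits.QuantumFields.YangMills.Theses.DirichletWindow
import Literature.MathematicalPhysics.QuantumFieldTheory.GaugeOSData
import Summits.QuantumFields.YangMills.Theorems.DirichletWindowCriticalityOfXiDiverges
import HarnessLib

/-!
# `ContinuumLegGivenGap` (stmt-QuantumFields-8782): threshold absorption and the canonical dock

Support file for the crux item stmt-QuantumFields-8782 (line `Sketch`, lead), continuing
`ConvexGribovBodyContinuumLegGivenGapDock.lean`.

The crux's hypothesis at `(G, r)` carries a volume threshold `S ≥ S₁(β)`; the hypothesis of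
stmt-9443 (`FradkinShenkerFlow.ClusteringToYangMills`) does not. The threshold is cosmetic: below it
there are only finitely many pairs `(S, n)` with `n ≤ S`, so it is absorbed into the pair constants
(`stub_thresholdAbsorption`, a registered sub-goal of the crux). Hence the crux's hypothesis at
`(G, r)` is EXACTLY 9443's `∃ β₀ ∀ β ≥ β₀ ∃ m > 0, TorusClusteringAt r β m`
(`gapHyp_iff_torusClusteringAt`), and the dock takes its canonical form
`continuumLegGivenGap_of_canonicalDock`: ONE adapter (per-β torus clustering ⇒ β-free pair
constants — the same statement serves 8782 and 9443) + `XiDiverges` (stmt-8941) +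
`CriticalContinuumLimit` (stmt-8762) ⊢ the crux (the glue stmt-12318 is proved in the tree,
`Theorems/DirichletWindowCriticalityOfXiDiverges.lean`).

Pure logic and one finite sum; no definitions, no facts.
-/

namespace Summit.QuantumFields.YangMills.Theorems.ContinuumLegGivenGap

open Filter
open Literature.MathematicalPhysics.QuantumFieldTheory
open Summit.QuantumFields.YangMills.Theses

/-- **Threshold absorption** (registered sub-goal `stub_thresholdAbsorption` of stmt-8782): a volume
threshold `S ≥ S₁` in a torus clustering bound at one coupling costs nothing — below the threshold
there are finitely many `(S, n)` with `n ≤ S`, and the constant is enlarged pair by pair by the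
finite sum `∑_{S<S₁} ∑_{n≤S} |corr_S(n)| e^{m n}`. [folklore] -/
theorem stub_thresholdAbsorption :
    ∀ (G : Type) [Group G] [TopologicalSpace G] [IsTopologicalGroup G] [CompactSpace G]
      [MeasurableSpace G] [BorelSpace G] (r : LatticeRep G) (β m : ℝ) (S₁ : ℕ),
      (∀ A B : YMSpecies G, ∃ C : ℝ, ∀ S n : ℕ, S₁ ≤ S → n ≤ S →
        |latticeConnectedCorr r.ρ β (2 * S + 1) A.F B.F n| ≤ C * Real.exp (-(m * n))) →
      TorusClusteringAt r β m := by
  intro G _ _ _ _ _ _ r β m S₁ h A B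
  obtain ⟨C, hC⟩ := h A B
  let D : ℝ := ∑ S ∈ Finset.range S₁, ∑ n ∈ Finset.range (S + 1),
    |latticeConnectedCorr r.ρ β (2 * S + 1) A.F B.F n| * Real.exp (m * n)
  refine ⟨max C D, fun S n hn => ?_⟩
  have hexp : 0 < Real.exp (-(m * n)) := Real.exp_pos _
  by_cases hS : S₁ ≤ S
  · exact (hC S n hS hn).trans (mul_le_mul_of_nonneg_right (le_max_left _ _) hexp.le)
  · have hS' : S ∈ Finset.range S₁ := Finset.mem_range.2 (lt_of_not_ge hS)
    have hn' : n ∈ Finset.range (S + 1) := Finset.mem_range.2 (Nat.lt_succ_of_le hn)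
    have hterm : |latticeConnectedCorr r.ρ β (2 * S + 1) A.F B.F n| * Real.exp (m * n) ≤ D := by
      have h1 : |latticeConnectedCorr r.ρ β (2 * S + 1) A.F B.F n| * Real.exp (m * n) ≤
          ∑ n' ∈ Finset.range (S + 1),
            |latticeConnectedCorr r.ρ β (2 * S + 1) A.F B.F n'| * Real.exp (m * n') :=
        Finset.single_le_sum (f := fun n' => |latticeConnectedCorr r.ρ β (2 * S + 1) A.F B.F n'| *
          Real.exp (m * n')) (fun n' _ => by positivity) hn'
      refine h1.trans ?_
      exact Finset.single_le_sum (f := fun S' => ∑ n' ∈ Finset.range (S' + 1),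
          |latticeConnectedCorr r.ρ β (2 * S' + 1) A.F B.F n'| * Real.exp (m * n'))
        (fun S' _ => Finset.sum_nonneg fun n' _ => by positivity) hS'
    have hkey : |latticeConnectedCorr r.ρ β (2 * S + 1) A.F B.F n| =
        |latticeConnectedCorr r.ρ β (2 * S + 1) A.F B.F n| * Real.exp (m * n) *
          Real.exp (-(m * n)) := by
      rw [mul_assoc, ← Real.exp_add, add_neg_cancel, Real.exp_zero, mul_one]
    rw [hkey]
    exact mul_le_mul_of_nonneg_right (hterm.trans (le_max_right _ _)) hexp.le

/-- **The crux's hypothesis at `(G, r)` is stmt-9443's**: per-β rate, volume threshold and per-pair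
constants ⟺ per-β rate and per-pair constants on ALL odd symmetric tori (`TorusClusteringAt`).
[folklore] -/
theorem gapHyp_iff_torusClusteringAt {G : Type} [Group G] [TopologicalSpace G]
    [IsTopologicalGroup G] [CompactSpace G] [MeasurableSpace G] [BorelSpace G] (r : LatticeRep G) :
    (∃ β₀ : ℝ, ∀ β : ℝ, β₀ ≤ β → ∃ m : ℝ, 0 < m ∧ ∃ S₁ : ℕ, ∀ A B : YMSpecies G, ∃ C : ℝ,
      ∀ S n : ℕ, S₁ ≤ S → n ≤ S →
        |latticeConnectedCorr r.ρ β (2 * S + 1) A.F B.F n| ≤ C * Real.exp (-(m * n))) ↔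
    ∃ β₀ : ℝ, ∀ β : ℝ, β₀ ≤ β → ∃ m : ℝ, 0 < m ∧ TorusClusteringAt r β m := by
  constructor
  · rintro ⟨β₀, h⟩
    refine ⟨β₀, fun β hβ => ?_⟩
    obtain ⟨m, hm, S₁, hS⟩ := h β hβ
    exact ⟨m, hm, stub_thresholdAbsorption G r β m S₁ hS⟩
  · rintro ⟨β₀, h⟩
    refine ⟨β₀, fun β hβ => ?_⟩
    obtain ⟨m, hm, hT⟩ := h β hβ
    exact ⟨m, hm, 0, fun A B => (hT A B).imp fun C hC S n _ hn => hC S n hn⟩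

/-- **The canonical dock of stmt-8782.** ONE adapter — at every compact simple `(G, r)`, per-β
volume-uniform torus clustering (`TorusClusteringAt r β m(β)` above `β₀`, per-pair per-β constants)
upgrades to β-FREE pair constants with a rate function and a threshold function (hypothesis (1) of
stmt-8762; the SAME statement is the adapter of stmt-9443's lines) — together with `XiDiverges`
(stmt-8941) and the hub `CriticalContinuumLimit` (stmt-8762) proves the crux; the glue
`CriticalityOfXiDiverges` (stmt-12318) is the tree's `criticalityOfXiDiverges_proof`. Conditional
result (adapter, 8941 and 8762 open). [folklore] -/
theorem continuumLegGivenGap_of_canonicalDock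
    (hAdapter : ∀ (G : Type) [Group G] [TopologicalSpace G] [IsTopologicalGroup G] [CompactSpace G]
      [MeasurableSpace G] [BorelSpace G], IsCompactSimpleLieGroup G → ∀ r : LatticeRep G,
      (∃ β₀ : ℝ, ∀ β : ℝ, β₀ ≤ β → ∃ m : ℝ, 0 < m ∧ TorusClusteringAt r β m) →
        ∃ (β₁ : ℝ) (m : ℝ → ℝ) (S₀ : ℝ → ℕ), (∀ β : ℝ, β₁ ≤ β → 0 < m β) ∧
          ∀ A B : YMSpecies G, ∃ C : ℝ, ∀ β : ℝ, β₁ ≤ β → ∀ S n : ℕ, S₀ β ≤ S → n ≤ S →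
            |latticeConnectedCorr r.ρ β (2 * S + 1) A.F B.F n| ≤ C * Real.exp (-(m β * n)))
    (hXi : DirichletWindow.XiDiverges) (hHub : EquipartitionCriticality.CriticalContinuumLimit) :
    ConvexGribovBody.ContinuumLegGivenGap := by
  intro G _ _ _ _ hG
  letI : MeasurableSpace G := borel G
  haveI : BorelSpace G := ⟨rfl⟩
  intro hH
  exact hHub G hG (fun r => hAdapter G hG r ((gapHyp_iff_torusClusteringAt r).1 (hH r)))
    (fun r => Summit.QuantumFields.YangMills.Theorems.criticalityOfXiDiverges_proof hXi G hG r)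

end Summit.QuantumFields.YangMills.Theorems.ContinuumLegGivenGap
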